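import Mathlib
import Literature.NumberTheory.QuadraticFields.BakerLimitFormulaCharSums

/-!
# Stub `stub_tangencySets` (crux `LevelOneGL2Designs`, stmt-MatrixMultiplication-14080) —
wall-breaker axis 1/12 "Hermitian unital constructions", part 2: the unitary (norm-circle) family
over the PRIME field — construction and rigidity

The stub asks for strong representative systems (tangency sets) of `AG(2,p)` of size `c·p^{3/2}`
for unboundedly many PRIMES `p`.  The Hermitian axis owns the one configuration that reaches this
size anywhere — the classical unital of a square-order plane (`FlagLine.TangencyHermitian.hermitian_srs`,
axis 10) — and part 1 of this axis (`…StubTangencySetsHermitianDescent.lean`) showed that its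
restriction to the prime subplane is a conic (`≤ q` points).  This file treats the intrinsic
prime-field form of the same structure.  Over `𝔽_p` the Hermitian form in ONE variable of
`𝔽_{p²}/𝔽_p` is the norm `N(x,y) = x² − n y²` (`n` a non-square) on `AG(2,p) ≅ 𝔽_{p²}`; its
unitary group `U₁ = μ_{p+1}` acts by the rotations `ρ_{c,s}` (`c² − n s² = 1`) and its orbits are
the `p − 1` norm circles `N = a`, `a ≠ 0`, of `p + 1` points each (`card_circle`).  A
`U₁`-invariant point set is a union of circles `P_A = N⁻¹(A)`, `A ⊆ 𝔽_p ∖ {0}`.  We prove: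

* `circleUnion_srs` (CONSTRUCTION): if `a(a − a')` is a square for all `a, a' ∈ A` (a *character
  clique*), the points of `P_A` with the tangents of their own circles are an SRS of size
  `(p+1)·|A|` in the stub's exact dot-product format;
* `isSquare_of_privateLine` (RIGIDITY): conversely, if a point of `P_A` has ANY private line in
  `P_A` then `N(v)(N(v) − a')` is a square for every `a' ∈ A` — a non-tangent line is a secant of
  the point's own circle, and along the tangent the norm takes the values `a(1 − n t²)`.

So inside the unitary family the tangency property is EQUIVALENT to the character-clique
condition; part 3 (`…HermitianCirclesRigidity.lean`) turns this into: `|A| ≤ 2` when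
`p ≡ 3 (mod 4)`, and `A` = a Paley clique inside the squares (or a coclique inside the
non-squares) when `p ≡ 1 (mod 4)`, whence every `U₁`-invariant tangency set of `AG(2,p)` has at
most `(p+1)·ω + 1` points, `ω² ≤ p` the Paley clique number — the unitary family reduces the stub
to (and is capped by) the Paley clique problem, the residual already isolated by the parabola
pencils of axes 11/12 (`ParabolaLift.tangencySets_of_large_cocliques`).
Tools: Brahmagupta's identity `N(v)N(w) = ⟨v,w⟩² − n[v,w]²` (`norm_mul_norm`), anisotropy, and the
circle count via `Σ_y χ(y² − c) = −1` (`Literature…BakerLimitFormula.sum_quadraticChar_sq_sub`).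
Elementary; no new definitions (the norm is written out as `v 0 ^ 2 - n * v 1 ^ 2` throughout).
-/

set_option linter.dupNamespace false

namespace Summit.MatrixMultiplication.MatrixMultiplication.Theorems.LevelOneGL2Designs.HermitianUnital

open Finset Matrix

variable {p : ℕ} [hp : Fact p.Prime]

section NormForm

variable {n : ZMod p}

/-- A field with a non-square has characteristic `≠ 2`. [elementary] -/
theorem ringChar_ne_two_of_not_isSquare (hn : ¬ IsSquare n) : ringChar (ZMod p) ≠ 2 :=
  fun h => hn (FiniteField.isSquare_of_char_two h n)

/-- A field with a non-square has `2 ≠ 0`. [elementary] -/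
theorem two_ne_zero_of_not_isSquare (hn : ¬ IsSquare n) : (2 : ZMod p) ≠ 0 :=
  Ring.two_ne_zero (ringChar_ne_two_of_not_isSquare hn)

/-- A non-square is nonzero. [elementary] -/
theorem ne_zero_of_not_isSquare (hn : ¬ IsSquare n) : n ≠ 0 :=
  fun h => hn (h ▸ IsSquare.zero)

/-- A non-square times a nonzero square is a non-square. [elementary] -/
theorem not_isSquare_mul_sq (hn : ¬ IsSquare n) {s : ZMod p} (hs : s ≠ 0) :
    ¬ IsSquare (n * s ^ 2) := by
  rintro ⟨r, hr⟩
  apply hn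
  refine ⟨r / s, ?_⟩
  field_simp
  linear_combination hr

/-- The quotient of two non-squares of `ZMod p` is a square. [elementary] -/
theorem isSquare_div_of_not_isSquare {x y : ZMod p} (hx : ¬ IsSquare x) (hy : ¬ IsSquare y) :
    IsSquare (x / y) := by
  have hx0 : x ≠ 0 := fun h => hx (h ▸ IsSquare.zero)
  have hy0 : y ≠ 0 := fun h => hy (h ▸ IsSquare.zero)
  have hχx := quadraticChar_neg_one_iff_not_isSquare.mpr hx
  have hχy := quadraticChar_neg_one_iff_not_isSquare.mpr hy
  have hxy : IsSquare (x * y) :=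
    (quadraticChar_one_iff_isSquare (mul_ne_zero hx0 hy0)).mp (by rw [map_mul, hχx, hχy]; norm_num)
  have h : x / y = x * y / (y * y) := by field_simp
  rw [h]
  exact hxy.div ⟨y, rfl⟩

/-- **Anisotropy of the norm form.**  For a non-square `n`, `x² − n·y² = 0` only for
`x = y = 0`: `N(x,y) = x² − n y²` is the norm form of `𝔽_{p²} = 𝔽_p(√n)` on `AG(2,p)`.
[elementary] -/
theorem norm_eq_zero_iff (hn : ¬ IsSquare n) (x y : ZMod p) :
    x ^ 2 - n * y ^ 2 = 0 ↔ x = 0 ∧ y = 0 := by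
  constructor
  · intro h
    by_cases hy : y = 0
    · subst hy
      have hx : x ^ 2 = 0 := by simpa using h
      exact ⟨pow_eq_zero_iff (two_ne_zero) |>.mp hx, rfl⟩
    · exact absurd ⟨x, by linear_combination -h⟩ (not_isSquare_mul_sq hn hy)
  · rintro ⟨rfl, rfl⟩
    ring

/-- **Multiplicativity (Brahmagupta's identity)**: `N(v)·N(w) = ⟨v,w⟩² − n·[v,w]²` with
`⟨v,w⟩ = v₀w₀ − n v₁w₁` the polar form and `[v,w] = v₀w₁ − v₁w₀`. [elementary] -/
theorem norm_mul_norm (n v₀ v₁ w₀ w₁ : ZMod p) :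
    (v₀ ^ 2 - n * v₁ ^ 2) * (w₀ ^ 2 - n * w₁ ^ 2) =
      (v₀ * w₀ - n * v₁ * w₁) ^ 2 - n * (v₀ * w₁ - v₁ * w₀) ^ 2 := by
  ring

/-- **The unitary group acts by isometries**: the rotation `ρ_{c,s} : (x,y) ↦ (cx + nsy, sx + cy)`
(multiplication by `c + s√n` in `𝔽_p(√n)`) multiplies norms by `c² − n s²`. [elementary] -/
theorem norm_rotate (n c s x y : ZMod p) :
    (c * x + n * s * y) ^ 2 - n * (s * x + c * y) ^ 2 = (c ^ 2 - n * s ^ 2) * (x ^ 2 - n * y ^ 2) := by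
  ring

/-- **Every norm circle has `p + 1` points**: for a non-square `n` and `a ≠ 0`,
`#{v ∈ 𝔽_p² : v₀² − n v₁² = a} = p + 1` (the circle is a coset of the norm-one group
`U₁ = μ_{p+1}` of `𝔽_{p²}`).  Proof: over each `y` there are `χ(a + n y²) + 1` values of `x`, and
`Σ_y χ(a + n y²) = χ(n) Σ_y χ(y² + a/n) = (−1)·(−1)`. [folklore] -/
theorem card_circle (hn : ¬ IsSquare n) {a : ZMod p} (ha : a ≠ 0) :
    (univ.filter fun v : Fin 2 → ZMod p => v 0 ^ 2 - n * v 1 ^ 2 = a).card = p + 1 := by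
  classical
  have hF := ringChar_ne_two_of_not_isSquare hn
  have hn0 := ne_zero_of_not_isSquare hn
  -- fibres over the second coordinate
  have hfib : ∀ y : ZMod p,
      ((univ.filter fun x : ZMod p => x ^ 2 - n * y ^ 2 = a).card : ℤ) =
        quadraticChar (ZMod p) (a + n * y ^ 2) + 1 := by
    intro y
    have h := quadraticChar_card_sqrts hF (a + n * y ^ 2)
    rw [Set.toFinset_setOf] at h
    have heq : (univ.filter fun x : ZMod p => x ^ 2 - n * y ^ 2 = a) =
        (univ.filter fun x : ZMod p => x ^ 2 = a + n * y ^ 2) := by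
      ext x
      simp only [mem_filter, mem_univ, true_and]
      constructor <;> intro hx <;> linear_combination hx
    rw [heq, h]
  -- the character sum
  have hsum : ∑ y : ZMod p, quadraticChar (ZMod p) (a + n * y ^ 2) = 1 := by
    have hχn : quadraticChar (ZMod p) n = -1 := quadraticChar_neg_one_iff_not_isSquare.mpr hn
    have hc : -a / n ≠ 0 := div_ne_zero (neg_ne_zero.mpr ha) hn0
    have key : ∀ y : ZMod p, quadraticChar (ZMod p) (a + n * y ^ 2) =
        quadraticChar (ZMod p) n * quadraticChar (ZMod p) (y ^ 2 - -a / n) := by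
      intro y
      rw [← map_mul]
      congr 1
      field_simp
      ring
    simp_rw [key]
    rw [← Finset.mul_sum,
      Literature.NumberTheory.QuadraticFields.BakerLimitFormula.sum_quadraticChar_sq_sub hF hc, hχn]
    norm_num
  -- count over pairs
  have hpairs : (((univ.filter fun xy : ZMod p × ZMod p => xy.1 ^ 2 - n * xy.2 ^ 2 = a).card : ℕ) : ℤ)
      = p + 1 := by
    have h1 : (univ.filter fun xy : ZMod p × ZMod p => xy.1 ^ 2 - n * xy.2 ^ 2 = a).card =
        ∑ y : ZMod p, (univ.filter fun x : ZMod p => x ^ 2 - n * y ^ 2 = a).card := by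
      rw [card_filter, Fintype.sum_prod_type_right]
      simp_rw [card_filter]
    rw [h1, Nat.cast_sum]
    simp_rw [hfib]
    rw [Finset.sum_add_distrib, hsum, Finset.sum_const, card_univ, ZMod.card, nsmul_eq_mul, mul_one]
    ring
  -- transport to `Fin 2 → ZMod p`
  have h2 : (univ.filter fun v : Fin 2 → ZMod p => v 0 ^ 2 - n * v 1 ^ 2 = a).card =
      (univ.filter fun xy : ZMod p × ZMod p => xy.1 ^ 2 - n * xy.2 ^ 2 = a).card := by
    refine Finset.card_bij' (fun v _ => (v 0, v 1)) (fun xy _ => ![xy.1, xy.2]) ?_ ?_ ?_ ?_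
    · intro v hv
      simpa only [mem_filter, mem_univ, true_and] using hv
    · intro xy hxy
      simpa only [mem_filter, mem_univ, true_and, cons_val_zero, cons_val_one] using hxy
    · intro v _
      funext i
      fin_cases i <;> rfl
    · intro xy _
      rfl
  rw [h2]
  exact_mod_cast hpairs

/-- **Norms are surjective**: every `a ≠ 0` is a norm `v₀² − n v₁²`. [folklore] -/
theorem exists_norm_eq (hn : ¬ IsSquare n) {a : ZMod p} (ha : a ≠ 0) :
    ∃ v : Fin 2 → ZMod p, v 0 ^ 2 - n * v 1 ^ 2 = a := by
  classical
  have h := card_circle hn ha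
  have hne : (univ.filter fun v : Fin 2 → ZMod p => v 0 ^ 2 - n * v 1 ^ 2 = a).Nonempty := by
    rw [← Finset.card_pos, h]
    omega
  obtain ⟨v, hv⟩ := hne
  exact ⟨v, by simpa using hv⟩

/-- **A union of norm circles over `A ⊆ 𝔽_p ∖ {0}` has `(p+1)·|A|` points.** [elementary] -/
theorem card_circleUnion (hn : ¬ IsSquare n) (A : Finset (ZMod p)) (hA0 : (0 : ZMod p) ∉ A) :
    (univ.filter fun v : Fin 2 → ZMod p => v 0 ^ 2 - n * v 1 ^ 2 ∈ A).card = (p + 1) * A.card := by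
  classical
  rw [card_eq_sum_card_fiberwise (f := fun v : Fin 2 → ZMod p => v 0 ^ 2 - n * v 1 ^ 2) (t := A)
    (fun v hv => by simpa using hv)]
  have h : ∀ a ∈ A, ((univ.filter fun v : Fin 2 → ZMod p => v 0 ^ 2 - n * v 1 ^ 2 ∈ A).filter
      fun v => v 0 ^ 2 - n * v 1 ^ 2 = a).card = p + 1 := by
    intro a ha
    have ha0 : a ≠ 0 := fun h => hA0 (h ▸ ha)
    rw [← card_circle hn ha0]
    congr 1
    ext v
    simp only [mem_filter, mem_univ, true_and]
    exact ⟨fun h => h.2, fun h => ⟨h ▸ ha, h⟩⟩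
  rw [sum_congr rfl h, sum_const, smul_eq_mul, mul_comm]

end NormForm

/-! ## The unitary family: unions of norm circles and their tangents -/

section Circles

variable {n : ZMod p}

/-- **The unitary (norm-circle) family — construction.**  Let `n` be a non-square of `𝔽_p` and
`A ⊆ 𝔽_p ∖ {0}` a *character clique*: `a·(a − a')` is a square for all `a, a' ∈ A`.  Then the
`(p+1)·|A|` flags `( (v₀/N(v), −n v₁/N(v)) , v )`, `N(v) = v₀² − n v₁² ∈ A` — each point of the
norm circle `N = a` together with its tangent `v₀ X − n v₁ Y = a` (the polar line, rescaled to
right-hand side `1`) — satisfy `u_f ⬝ᵥ v_{f'} = 1 ↔ f = f'`, i.e. they form a strong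
representative system of `AG(2,p)` in the exact format of `stub_tangencySets`.  Key step: if the
tangent at `v` (circle `a`) passes through `w` (circle `a'`) then Brahmagupta's identity gives
`a(a − a') = n·[v,w]²`, a non-square unless `[v,w] = 0`, and then `N(w − v) = 0`.
This is the prime-field avatar of the Hermitian-curve SRS (`FlagLine.TangencyHermitian.hermitian_srs`):
the Hermitian form in one variable over `𝔽_{p²}/𝔽_p` is the norm `N`, its unitary group is
`U₁ = μ_{p+1}`, and the circles are its orbits. [elementary; construction of this axis] -/
theorem circleUnion_srs (hn : ¬ IsSquare n) (A : Finset (ZMod p)) (hA0 : (0 : ZMod p) ∉ A)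
    (hA : ∀ a ∈ A, ∀ a' ∈ A, IsSquare (a * (a - a'))) :
    ∃ S : Finset ((Fin 2 → ZMod p) × (Fin 2 → ZMod p)), S.card = (p + 1) * A.card ∧
      ∀ f ∈ S, ∀ f' ∈ S, (dotProduct f.1 f'.2 = 1 ↔ f = f') := by
  classical
  set P := univ.filter fun v : Fin 2 → ZMod p => v 0 ^ 2 - n * v 1 ^ 2 ∈ A with hP
  let Φ : (Fin 2 → ZMod p) → (Fin 2 → ZMod p) × (Fin 2 → ZMod p) := fun v =>
    (![v 0 / (v 0 ^ 2 - n * v 1 ^ 2), -(n * v 1) / (v 0 ^ 2 - n * v 1 ^ 2)], v)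
  have hΦ : Function.Injective Φ := fun v w h => congrArg Prod.snd h
  refine ⟨P.image Φ, ?_, ?_⟩
  · rw [card_image_of_injective _ hΦ, hP, card_circleUnion hn A hA0]
  · simp only [mem_image]
    rintro f ⟨v, hv, rfl⟩ f' ⟨w, hw, rfl⟩
    simp only [hP, mem_filter, mem_univ, true_and] at hv hw
    rw [hΦ.eq_iff]
    obtain ⟨a, ha⟩ : ∃ a, v 0 ^ 2 - n * v 1 ^ 2 = a := ⟨_, rfl⟩
    obtain ⟨a', ha'⟩ : ∃ a', w 0 ^ 2 - n * w 1 ^ 2 = a' := ⟨_, rfl⟩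
    rw [ha] at hv
    rw [ha'] at hw
    have ha0 : a ≠ 0 := fun h => hA0 (h ▸ hv)
    simp only [Φ, vec2_dotProduct, cons_val_zero, cons_val_one]
    rw [ha]
    constructor
    · intro h
      have hB : v 0 * w 0 - n * v 1 * w 1 = a := by
        field_simp at h
        linear_combination h
      have hBr := norm_mul_norm n (v 0) (v 1) (w 0) (w 1)
      rw [ha, ha', hB] at hBr
      -- `hBr : a * a' = a ^ 2 - n * [v,w] ^ 2`
      have hs : v 0 * w 1 - v 1 * w 0 = 0 := by
        by_contra hs
        refine not_isSquare_mul_sq hn hs ?_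
        have e : n * (v 0 * w 1 - v 1 * w 0) ^ 2 = a * (a - a') := by linear_combination hBr
        rw [e]
        exact hA a hv a' hw
      rw [hs] at hBr
      have haa : a' = a := by
        have e : a * (a' - a) = 0 := by linear_combination hBr
        rcases mul_eq_zero.mp e with e | e
        · exact absurd e ha0
        · linear_combination e
      have hN : (w 0 - v 0) ^ 2 - n * (w 1 - v 1) ^ 2 = 0 := by
        linear_combination ha' + ha - 2 * hB + haa
      obtain ⟨h0, h1⟩ := (norm_eq_zero_iff hn _ _).mp hN
      funext i
      fin_cases i
      · exact (sub_eq_zero.mp h0).symm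
      · exact (sub_eq_zero.mp h1).symm
    · rintro rfl
      field_simp
      linear_combination ha

/-- **The unitary family — rigidity (converse).**  Let `A ⊆ 𝔽_p ∖ {0}` and let `v` be a point
of the circle union `P_A = {w : N(w) ∈ A}` that has a private line in `P_A` (a line through `v`,
in arbitrary position, containing no other point of `P_A`).  Then `N(v)·(N(v) − a')` is a square
for every `a' ∈ A`.  Proof: a non-tangent line through `v` is a secant of `v`'s own circle; the
tangent direction `d` has `N(v)·N(d) = −n·[v,d]²`, and if `N(v)(N(v) − a')` were a non-square the
equation `N(v + t d) = a'` would have a solution `t ≠ 0`. So inside the unitary family the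
character-clique condition of `circleUnion_srs` is NECESSARY, for any choice of tangents.
[elementary] -/
theorem isSquare_of_privateLine (hn : ¬ IsSquare n) (A : Finset (ZMod p)) (hA0 : (0 : ZMod p) ∉ A)
    {v : Fin 2 → ZMod p} (hv : v 0 ^ 2 - n * v 1 ^ 2 ∈ A)
    (hpriv : ∃ u : Fin 2 → ZMod p, u ≠ 0 ∧ ∀ w : Fin 2 → ZMod p,
      w 0 ^ 2 - n * w 1 ^ 2 ∈ A → u ⬝ᵥ w = u ⬝ᵥ v → w = v)
    {a' : ZMod p} (ha' : a' ∈ A) :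
    IsSquare ((v 0 ^ 2 - n * v 1 ^ 2) * ((v 0 ^ 2 - n * v 1 ^ 2) - a')) := by
  classical
  obtain ⟨u, hu0, hu⟩ := hpriv
  obtain ⟨a, ha⟩ : ∃ a, v 0 ^ 2 - n * v 1 ^ 2 = a := ⟨_, rfl⟩
  rw [ha] at hv ⊢
  have ha0 : a ≠ 0 := fun h => hA0 (h ▸ hv)
  have hn0 := ne_zero_of_not_isSquare hn
  have h2 := two_ne_zero_of_not_isSquare hn
  -- the line through `v` with normal `u`: points `v + t·(u₁, −u₀)`
  have hline : ∀ t : ZMod p, u ⬝ᵥ ![v 0 + t * u 1, v 1 - t * u 0] = u ⬝ᵥ v := by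
    intro t
    simp only [vec2_dotProduct, cons_val_zero, cons_val_one]
    ring
  have hexcl : ∀ t : ZMod p, t ≠ 0 → (v 0 + t * u 1) ^ 2 - n * (v 1 - t * u 0) ^ 2 ∉ A := by
    intro t ht hmem
    have hw := hu ![v 0 + t * u 1, v 1 - t * u 0]
      (by simpa only [cons_val_zero, cons_val_one] using hmem) (hline t)
    have e0 : t * u 1 = 0 := by
      have := congrFun hw 0
      simp only [cons_val_zero] at this
      linear_combination this
    have e1 : t * u 0 = 0 := by
      have := congrFun hw 1
      simp only [cons_val_one, cons_val_zero] at this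
      linear_combination -this
    apply hu0
    funext i
    fin_cases i
    · exact (mul_eq_zero.mp e1).resolve_left ht
    · exact (mul_eq_zero.mp e0).resolve_left ht
  -- expansion of the norm along the line
  set B := v 0 * u 1 + n * (v 1 * u 0) with hB
  set C := u 1 ^ 2 - n * u 0 ^ 2 with hC
  set s := v 0 * u 0 + v 1 * u 1 with hs
  have hexp : ∀ t : ZMod p,
      (v 0 + t * u 1) ^ 2 - n * (v 1 - t * u 0) ^ 2 = a + 2 * t * B + t ^ 2 * C := by
    intro t
    rw [hB, hC, ← ha]
    ring
  have hC0 : C ≠ 0 := by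
    intro hC0
    obtain ⟨e1, e0⟩ := (norm_eq_zero_iff hn (u 1) (u 0)).mp (by rw [hC] at hC0; exact hC0)
    apply hu0
    funext i
    fin_cases i
    · exact e0
    · exact e1
  -- Step 1: the private line is the tangent (`B = 0`), otherwise it is a secant of the circle `a`
  have hB0 : B = 0 := by
    by_contra hB0
    have ht : -(2 * B) / C ≠ 0 := div_ne_zero (neg_ne_zero.mpr (mul_ne_zero h2 hB0)) hC0
    apply hexcl _ ht
    rw [hexp]
    have e : a + 2 * (-(2 * B) / C) * B + (-(2 * B) / C) ^ 2 * C = a := by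
      field_simp
      ring
    rw [e]
    exact hv
  -- Step 2: Brahmagupta `a·C = B² − n·s²`, so `a·C = −n s²` with `s ≠ 0`
  have hBr : a * C = B ^ 2 - n * s ^ 2 := by
    rw [← ha, hC, hB, hs]
    ring
  rw [hB0] at hBr
  have hs0 : s ≠ 0 := by
    intro h0
    rw [h0] at hBr
    exact mul_ne_zero ha0 hC0 (by linear_combination hBr)
  -- Step 3: if `a(a − a')` were a non-square, `N(v + t d) = a'` would be soluble with `t ≠ 0`
  by_contra hnsq
  have hne : a - a' ≠ 0 := by
    intro h
    apply hnsq
    rw [h, mul_zero]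
    exact IsSquare.zero
  obtain ⟨t, ht⟩ := isSquare_div_of_not_isSquare hnsq (not_isSquare_mul_sq hn hs0)
  have ht0 : t ≠ 0 := by
    rintro rfl
    rw [mul_zero, div_eq_zero_iff] at ht
    rcases ht with h | h
    · exact mul_ne_zero ha0 hne h
    · exact mul_ne_zero hn0 (pow_ne_zero 2 hs0) h
  apply hexcl t ht0
  rw [hexp, hB0]
  have hCval : C = -(n * s ^ 2) / a := by
    field_simp
    linear_combination hBr
  have e : a + 2 * t * 0 + t ^ 2 * C = a' := by
    rw [hCval, show t ^ 2 = a * (a - a') / (n * s ^ 2) by rw [ht]; ring]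
    field_simp
    ring
  rw [e]
  exact ha'

/-- **Circle unions are `U₁`-invariant**: the rotations `ρ_{c,s}` (`c² − n s² = 1`) preserve
`P_A = {v : N(v) ∈ A}`; with `circleUnion_srs` this shows that the bound of part 3
(`card_unitaryInvariant_tangencySet_le`) is attained by every character clique `A`. [elementary] -/
theorem circleUnion_invariant (A : Finset (ZMod p)) {v : Fin 2 → ZMod p}
    (hv : v 0 ^ 2 - n * v 1 ^ 2 ∈ A) {c s : ZMod p} (hcs : c ^ 2 - n * s ^ 2 = 1) :
    (c * v 0 + n * s * v 1) ^ 2 - n * (s * v 0 + c * v 1) ^ 2 ∈ A := by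
  rw [norm_rotate, hcs, one_mul]
  exact hv

end Circles

end Summit.MatrixMultiplication.MatrixMultiplication.Theorems.LevelOneGL2Designs.HermitianUnital
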